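import Mathlib
import HarnessLib
import Summits.CriticalPhenomena.CardyFormulaZ2.Theorems.CardyMagicRigidityMagicFormulaTLatticeReflection
import Summits.CriticalPhenomena.CardyFormulaZ2.Theorems.CardyMagicRigidityMagicFormulaTStubDilation
import Literature.Probability.Percolation.NestingWeightMeasurable
import Literature.Probability.Percolation.LoopRotationInvarianceProofs
import Literature.Probability.Percolation.LoopTraversalBound
import Literature.Probability.RandomPlanarGeometry.UnbasedLoopImage

/-!
# The interface loops of a reflected configuration are the reflected loops (crux `MagicFormulaT`)

Crux `Summit.CriticalPhenomena.CardyFormulaZ2.Theses.CardyMagicRigidity.MagicFormulaT`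
(stmt-CriticalPhenomena-4836), line `Sketch` — helper file 2/3 of the EXACT CENTRING identity
(`CardyMagicRigidityMagicFormulaTCentring`). Geometric half of the point-reflection symmetry of
`CardyMagicRigidityMagicFormulaTLatticeReflection`, on the unit lattice (mesh `1`):

* `hexCenter_reflect` — the face reflection `(v, j) ↦ (c − v − 1, rev j)` acts on face centres as
  the point reflection `z ↦ triEmbed c − z` of `ℂ`;
* `wind_imageOn_reflect` — winding numbers are invariant, junk values included:
  `W(p − u, p − z) = W(u, z)` (`Curve.wind_map_affine` with `a = −1`); the reflection of unbased
  loops (`UnbasedLoop.imageOn (p − ·) univ`) is an involution (`imageOn_reflect_imageOn_reflect`);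
* `imageOn_reflect_siteLoop` — the drawn loop of the reflected walk `γ.map ρH[c]` is the reflection
  of the drawn loop of `γ` (both are the polyline through the reflected face centres,
  `apply_polylineFrom`);
* `loops_siteLoopConfig_reflect` — hence the loops of `siteLoopConfig 1 ((Equiv.subLeft c) '' ω)`
  are exactly the reflections of the loops of `siteLoopConfig 1 ω`.

No definition is introduced (the face reflection is the local notation `ρH[c]`, as in file 1/3);
everything is proved from tree / Mathlib material; no named fact is used.
-/

noncomputable section

namespace Summit.CriticalPhenomena.CardyFormulaZ2.Cruxes.MagicFormulaT.LineSketch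

open MeasureTheory Set
open Literature.Probability.Percolation Literature.Probability.LatticeModels

/-- The face reflection through `triEmbed c / 2`, as a graph endomorphism of the honeycomb
lattice (local notation, not a definition; see `hexGraph_adj_reflect`). -/
local notation3 "ρH[" c "]" =>
  (⟨fun F : HexVertex ↦ ((c : Site 2) - F.1 - 1, Fin.rev F.2), fun h ↦ hexGraph_adj_reflect c h⟩ :
    hexGraph →g hexGraph)

section LoopReflection

open Literature.Probability.RandomPlanarGeometry
open scoped unitInterval

/-! ## Face centres under the reflection -/

/-- `triEmbed 1 = 1 + ζ` (`(1 : Site 2) = e₀ + e₁`). -/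
theorem triEmbed_one : triEmbed (1 : Site 2) = 1 + triZeta := by
  simp [triEmbed]

/-- **The face reflection acts on face centres as the point reflection `z ↦ triEmbed c − z`.** -/
theorem hexCenter_reflect (c : Site 2) (F : HexVertex) :
    hexCenter (c - F.1 - 1, Fin.rev F.2) = triEmbed c - hexCenter F := by
  obtain ⟨v, j⟩ := F
  simp only [hexCenter, triEmbed_sub, triEmbed_one]
  fin_cases j
  · simp; ring
  · simp [Fin.rev]; ring

/-! ## Curves and unbased loops under the point reflection `z ↦ p − z` -/

/-- On curves, `Curve.imageOn (p - ·) univ` is the push-forward along the affine map `z ↦ (−1) z + p`. -/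
theorem curve_imageOn_reflect_eq_map (p : ℂ) (γ : Curve ℂ) :
    γ.imageOn (fun z ↦ p - z) univ = γ.map ⟨fun z ↦ (-1 : ℂ) * z + p, by fun_prop⟩ := by
  apply DFunLike.coe_injective
  funext t
  rw [Curve.imageOn_apply (by fun_prop) (subset_univ _), Curve.map_apply, ContinuousMap.coe_mk]
  ring

/-- **Winding numbers are invariant under point reflections, junk values included**:
`W(p − u, p − z) = W(u, z)`. -/
theorem wind_imageOn_reflect (p : ℂ) (u : UnbasedLoop ℂ) (z : ℂ) :
    (UnbasedLoop.imageOn (fun z ↦ p - z) univ u).wind (p - z) = u.wind z := by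
  obtain ⟨⟨c, hc⟩, rfl⟩ := UnbasedLoop.mk_surjective u
  obtain ⟨γ, rfl⟩ := CurveClass.surjective_mk c
  rw [UnbasedLoop.imageOn_mk, UnbasedLoop.wind_mk, UnbasedLoop.wind_mk,
    BasedLoop.toCurveClass_imageOn]
  change CurveClass.wind ((CurveClass.mk γ).imageOn (fun z ↦ p - z) univ) (p - z) =
    CurveClass.wind (CurveClass.mk γ) z
  rw [CurveClass.imageOn_mk, CurveClass.wind_mk, CurveClass.wind_mk, curve_imageOn_reflect_eq_map,
    ← Curve.wind_map_affine γ (neg_ne_zero.2 one_ne_zero) p z]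
  congr 1
  ring

/-- The point reflection of unbased loops is an involution. -/
theorem imageOn_reflect_imageOn_reflect (p : ℂ) (u : UnbasedLoop ℂ) :
    UnbasedLoop.imageOn (fun z ↦ p - z) univ (UnbasedLoop.imageOn (fun z ↦ p - z) univ u) = u :=
  UnbasedLoop.imageOn_imageOn (by fun_prop) (by fun_prop) (mapsTo_univ _ _)
    (fun z _ ↦ sub_sub_cancel p z) (subset_univ _)

/-- The point reflection of unbased loops is injective. -/
theorem imageOn_reflect_injective (p : ℂ) :
    Function.Injective (UnbasedLoop.imageOn (fun z ↦ p - z) (univ : Set ℂ)) :=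
  Function.LeftInverse.injective (g := UnbasedLoop.imageOn (fun z ↦ p - z) (univ : Set ℂ))
    (imageOn_reflect_imageOn_reflect p)

/-- Membership in a reflected set of loops. -/
theorem mem_image_imageOn_reflect_iff (p : ℂ) (L : Set (UnbasedLoop ℂ)) (u : UnbasedLoop ℂ) :
    u ∈ UnbasedLoop.imageOn (fun z ↦ p - z) univ '' L ↔
      UnbasedLoop.imageOn (fun z ↦ p - z) univ u ∈ L := by
  constructor
  · rintro ⟨u', hu', rfl⟩
    rwa [imageOn_reflect_imageOn_reflect]
  · intro hu
    exact ⟨_, hu, imageOn_reflect_imageOn_reflect p u⟩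

/-! ## The drawn loop of the reflected walk -/

/-- **The drawn loop of the reflected walk is the point reflection of the drawn loop** (mesh `1`),
as unbased loops: both are the polyline through the reflected face centres. -/
theorem imageOn_reflect_siteLoop (c : Site 2) {v : HexVertex} (γ : hexGraph.Walk v v) :
    UnbasedLoop.imageOn (fun z ↦ triEmbed c - z) univ
        (UnbasedLoop.mk (BasedLoop.mk (siteLoopCurve 1 γ) (isLoop_siteLoopCurve 1 γ))) =
      UnbasedLoop.mk (BasedLoop.mk (siteLoopCurve 1 (γ.map ρH[c]))
        (isLoop_siteLoopCurve 1 (γ.map ρH[c]))) := by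
  rw [UnbasedLoop.imageOn_mk]
  refine congrArg UnbasedLoop.mk ?_
  change BasedLoop.mk ((BasedLoop.mk (siteLoopCurve 1 γ) (isLoop_siteLoopCurve 1 γ)).toCurveClass.imageOn
    (fun z ↦ triEmbed c - z) univ) _ = _
  apply basedLoop_mk_congr
  rw [BasedLoop.toCurveClass_mk]
  change (CurveClass.mk (hexLoopCurve 1 γ)).imageOn (fun z ↦ triEmbed c - z) univ =
    CurveClass.mk (hexLoopCurve 1 (γ.map ρH[c]))
  rw [CurveClass.imageOn_mk]
  refine congrArg CurveClass.mk ?_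
  apply DFunLike.coe_injective
  funext t
  rw [Curve.imageOn_apply (by fun_prop) (subset_univ _)]
  change triEmbed c - (γ.toCurve fun F ↦ ((1 : ℝ) : ℂ) * hexCenter F) t =
    ((γ.map ρH[c]).toCurve fun F ↦ ((1 : ℝ) : ℂ) * hexCenter F) t
  simp only [SimpleGraph.Walk.toCurve, SimpleGraph.Walk.support_map, List.map_map]
  have key : γ.support.map ((fun F ↦ ((1 : ℝ) : ℂ) * hexCenter F) ∘ ⇑ρH[c]) =
      (γ.support.map fun F ↦ ((1 : ℝ) : ℂ) * hexCenter F).map fun z ↦ triEmbed c - z := by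
    rw [List.map_map]
    refine List.map_congr_left fun F _ ↦ ?_
    change ((1 : ℝ) : ℂ) * hexCenter (ρH[c] F) = triEmbed c - ((1 : ℝ) : ℂ) * hexCenter F
    rw [reflectHom_apply, hexCenter_reflect]
    push_cast
    ring
  rw [key, ← SimpleGraph.Walk.cons_tail_support γ, List.map_cons, List.map_cons]
  exact apply_polylineFrom (fun z : ℂ ↦ triEmbed c - z)
    (fun x y r ↦ by simp only [AffineMap.lineMap_apply_module', Complex.real_smul]; ring) _ _ t

/-! ## The loops of the reflected configuration -/

/-- The reflection of a loop of `ω` on the unit lattice is a loop of the reflected configuration. -/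
theorem imageOn_reflect_mem_loops (c : Site 2) {ω : SiteConfig (Site 2)} {u : UnbasedLoop ℂ}
    (hu : u ∈ (siteLoopConfig 1 ω).loops) :
    UnbasedLoop.imageOn (fun z ↦ triEmbed c - z) univ u ∈
      (siteLoopConfig 1 ((Equiv.subLeft c) '' ω)).loops := by
  rw [mem_loops_siteLoopConfig_iff] at hu ⊢
  obtain ⟨⟨v, γ⟩, hγ, rfl⟩ := hu
  exact ⟨⟨_, γ.map ρH[c]⟩, isSiteInterfaceLoop_reflect c hγ, (imageOn_reflect_siteLoop c γ).symm⟩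

/-- **The loops of the reflected configuration are the reflected loops** (mesh `1`). -/
theorem loops_siteLoopConfig_reflect (c : Site 2) (ω : SiteConfig (Site 2)) :
    (siteLoopConfig 1 ((Equiv.subLeft c) '' ω)).loops =
      UnbasedLoop.imageOn (fun z ↦ triEmbed c - z) univ '' (siteLoopConfig 1 ω).loops := by
  ext u
  rw [mem_image_imageOn_reflect_iff]
  constructor
  · intro hu
    have h := imageOn_reflect_mem_loops c hu
    rwa [image_subLeft_image_subLeft] at h
  · intro hu
    have h := imageOn_reflect_mem_loops c hu
    rwa [imageOn_reflect_imageOn_reflect] at h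

/-- **Sub-goal `loopReflection_loops` (helper file 2/3 of the exact centring identity of line
`Sketch`, crux `MagicFormulaT`): the loops of the reflected configuration are the reflected loops,
and winding numbers are reflection invariant.** -/
theorem loopReflection_loops :
    (∀ (c : Site 2) (ω : SiteConfig (Site 2)), (siteLoopConfig 1 ((Equiv.subLeft c) '' ω)).loops =
      UnbasedLoop.imageOn (fun z : ℂ ↦ triEmbed c - z) Set.univ '' (siteLoopConfig 1 ω).loops) ∧
    ∀ (p : ℂ) (u : UnbasedLoop ℂ) (z : ℂ),
      (UnbasedLoop.imageOn (fun z : ℂ ↦ p - z) Set.univ u).wind (p - z) = u.wind z :=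
  ⟨loops_siteLoopConfig_reflect, wind_imageOn_reflect⟩

end LoopReflection


end Summit.CriticalPhenomena.CardyFormulaZ2.Cruxes.MagicFormulaT.LineSketch

end
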